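import Mathlib
import Summits.Ventures.HodgeRepro2.T5GaussianField
import Summits.Ventures.HodgeRepro2.T5GaussianPlace
import Summits.Ventures.HodgeRepro2.T6N5LocalWeilQuotientKer
import Summits.Ventures.HodgeRepro2.T6N5LocalValuedTorsion

/-!
# T6N5LocalGaussianRefutation — Tier 6, M2 sub-step N5 (t6-p8's half): THE SUPERSEDED PER-PLACE STATEMENTS OF RECORD
ARE VACUOUS at `ℚ₂ ⊆ ℚ₂(i)` — `h35 → hsm → False` in kernel (README §10.5(ii)(a))

`T6N5LocalWeilQuotientKer` shows that the hypotheses `h35` (the Epsilon Dichotomy over ALL homomorphisms) and `hsm`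
(finite-index smoothness) of `N5Local_main_ram_completion_weil'` (p409783) force every conjugate-orthogonal
character of `L_w^×` to have a kernel of finite index. Here a conjugate-orthogonal character with INFINITE image is
exhibited at p4's concrete wild place `ℚ(ζ₄)/ℚ` at `2`:
* `T6N5LocalValuedTorsion.pow_ne_one_of_val_sub_one_lt`: where `v(2) ≤ v(p)` for every prime `p`, an element `z ≠ 1`
  with `v(z − 1) < v(2)` is not a root of unity;
* at the Gaussian place `x := 1 + 2ζ`, `y := σ(x)/x = (1 − 2ζ)/(1 + 2ζ)` has `v(y − 1) = v(4) < v(2)`, so `y` is not a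
  root of unity and the class of `x` in `U(V) = L_w^×/K_v^×` has infinite order (`x^n ∈ K_v^× ⇒ σ(x)^n = x^n`);
* `ℂ` is divisible, so the character `n ↦ n` of the infinite cyclic subgroup extends to `U(V)` (Baer:
  `Module.Baer.extension_property_addMonoidHom`), and `exp` of it is a conjugate-orthogonal character of `L_w^×`
  with the infinite image `{e^n}` (`exists_isCO_not_finiteIndex`);
* **`primed_hypotheses_false`**: for EVERY choice of the parameters `P`, `ψ_δ` and of the Weil representations `R`,
  `h35 → (∀ s, hsm s) → False` at `ℚ₂ ⊆ ℚ₂(i)` — the statement of record v1 is vacuous there; the repaired v2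
  (`T6N5LocalWeilQuotientSmooth`) is witnessed instead (`T6N5LocalGaussianWitness`).
README §8(d): uses an L-value-free non-vanishing device: NO.
-/

namespace Summit.Ventures.HodgeRepro2.T6.N5LocalGaussianRefutation

open Summit.Ventures.HodgeRepro2 IsDedekindDomain HeightOneSpectrum
  Summit.Ventures.HodgeRepro2.T6.N5LocalInertCompletion Summit.Ventures.HodgeRepro2.T6.N5LocalWeilQuotient
  Summit.Ventures.HodgeRepro2.T6.N5LocalWeilQuotientKer Summit.Ventures.HodgeRepro2.T6.N5LocalTateChars
  Summit.Ventures.HodgeRepro2.T6.N5LocalOnCompletionWeil Summit.Ventures.HodgeRepro2.T6.N5LocalValuedTorsion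

noncomputable section

/-! ### The Gaussian place: `x = 1 + 2ζ` has infinite order modulo `K_v^×` -/

section Gaussian

open T5GaussianField T5GaussianPlace

variable (w : HeightOneSpectrum (NumberField.RingOfIntegers L)) [w.asIdeal.LiesOver v₂.asIdeal]

/-- `ζ_w ∈ L_w`. -/
abbrev ζc : w.adicCompletion L := (ζw w : w.adicCompletion L)

omit [w.asIdeal.LiesOver v₂.asIdeal] in
/-- `ζ² = −1` in `L_w`. -/
theorem ζc_sq : ζc w ^ 2 = -1 := by
  unfold ζc ζw
  have : ((algebraMap (NumberField.RingOfIntegers L) (w.adicCompletionIntegers L) ζO : w.adicCompletionIntegers L) :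
      w.adicCompletion L) = algebraMap L (w.adicCompletion L) ζ := rfl
  rw [this]
  exact zeta_completion_sq w

omit [w.asIdeal.LiesOver v₂.asIdeal] in
/-- `v(ζ) = 1`. -/
theorem val_ζc : Valued.v (ζc w) = 1 := by
  have h := congrArg Valued.v (ζc_sq w)
  rw [map_pow, Valuation.map_neg, Valuation.map_one] at h
  have hne : Valued.v (ζc w) ≠ 0 := by
    intro h0
    rw [h0, zero_pow two_ne_zero] at h
    exact zero_ne_one h
  obtain ⟨k, hk⟩ : ∃ k : ℤ, Valued.v (ζc w) = WithZero.exp k := ⟨_, (WithZero.exp_log hne).symm⟩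
  rw [hk, ← WithZero.exp_nsmul] at h
  have h2 : (2 : ℕ) • k = 0 := WithZero.exp_injective (h.trans WithZero.exp_zero.symm)
  have hk0 : k = 0 := (smul_eq_zero.mp h2).resolve_left (by norm_num)
  rw [hk, hk0, WithZero.exp_zero]

/-- `v(2) = exp(−2)` in `L_w` (`2 = ζ³π²`). -/
theorem val_two_c : Valued.v (2 : w.adicCompletion L) = WithZero.exp (-2) := by
  have h' : (2 : w.adicCompletion L) = ζc w ^ 3 * (π w : w.adicCompletion L) ^ 2 := by
    have := congrArg (fun x : w.adicCompletionIntegers L => (x : w.adicCompletion L))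
      (two_eq_zetaw_pow_three_mul_pi_sq w)
    push_cast at this
    exact this
  rw [h', map_mul, map_pow, map_pow, val_ζc, one_pow, one_mul, val_pi_eq, ← WithZero.exp_nsmul]
  norm_num

/-- `v(2) < 1`. -/
theorem val_two_c_lt_one : Valued.v (2 : w.adicCompletion L) < 1 := by
  rw [val_two_c, ← WithZero.exp_zero]
  exact WithZero.exp_lt_exp.mpr (by norm_num)

/-- `v(p) = 1` for an odd prime `p` (Bézout against `2`). -/
theorem val_odd_prime (p : ℕ) (hp : p.Prime) (hp2 : p ≠ 2) : Valued.v ((p : ℕ) : w.adicCompletion L) = 1 := by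
  have hcop : IsCoprime (p : ℤ) (2 : ℤ) :=
    Nat.isCoprime_iff_coprime.mpr ((Nat.coprime_primes hp Nat.prime_two).mpr hp2)
  obtain ⟨a, b, hab⟩ := hcop
  have hcast : (a : w.adicCompletion L) * (p : w.adicCompletion L) + (b : w.adicCompletion L) * 2 = 1 := by
    have := congrArg (fun z : ℤ => (z : w.adicCompletion L)) hab
    push_cast at this
    exact this
  have hle : Valued.v ((p : ℕ) : w.adicCompletion L) ≤ 1 := val_natCast_le_one w p
  have ha : Valued.v (a : w.adicCompletion L) ≤ 1 := by
    rcases Int.eq_nat_or_neg a with ⟨n, hn | hn⟩ <;> rw [hn] <;> simp only [Int.cast_natCast, Int.cast_neg,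
      Valuation.map_neg] <;> exact val_natCast_le_one w n
  have hb : Valued.v (b : w.adicCompletion L) ≤ 1 := by
    rcases Int.eq_nat_or_neg b with ⟨n, hn | hn⟩ <;> rw [hn] <;> simp only [Int.cast_natCast, Int.cast_neg,
      Valuation.map_neg] <;> exact val_natCast_le_one w n
  by_contra hne
  have hlt : Valued.v ((p : ℕ) : w.adicCompletion L) < 1 := lt_of_le_of_ne hle hne
  have h1 : Valued.v ((a : w.adicCompletion L) * (p : w.adicCompletion L)) < 1 := by
    rw [map_mul]
    calc Valued.v (a : w.adicCompletion L) * Valued.v ((p : ℕ) : w.adicCompletion L)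
        ≤ 1 * Valued.v ((p : ℕ) : w.adicCompletion L) := mul_le_mul' ha le_rfl
      _ < 1 := by rw [one_mul]; exact hlt
  have h2 : Valued.v ((b : w.adicCompletion L) * 2) < 1 := by
    rw [map_mul]
    calc Valued.v (b : w.adicCompletion L) * Valued.v (2 : w.adicCompletion L)
        ≤ 1 * Valued.v (2 : w.adicCompletion L) := mul_le_mul' hb le_rfl
      _ < 1 := by rw [one_mul]; exact val_two_c_lt_one w
  have hmax : Valued.v ((a : w.adicCompletion L) * (p : w.adicCompletion L) + (b : w.adicCompletion L) * 2) ≤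
      max (Valued.v ((a : w.adicCompletion L) * (p : w.adicCompletion L))) (Valued.v ((b : w.adicCompletion L) * 2)) :=
    Valuation.map_add_le_max' _ _ _
  rw [hcast, Valuation.map_one] at hmax
  exact absurd hmax (not_le.mpr (max_lt h1 h2))

/-- `v(2) ≤ v(p)` for every prime `p`. -/
theorem val_two_le_val_prime (p : ℕ) (hp : p.Prime) :
    Valued.v (2 : w.adicCompletion L) ≤ Valued.v ((p : ℕ) : w.adicCompletion L) := by
  by_cases h : p = 2
  · subst h
    have h2 : ((2 : ℕ) : w.adicCompletion L) = 2 := Nat.cast_two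
    rw [h2]
  · have h1 : Valued.v (2 : w.adicCompletion L) ≤ 1 := le_of_lt (val_two_c_lt_one w)
    rw [val_odd_prime w p hp h]
    exact h1

/-- `x := 1 + 2ζ ∈ L_w`. -/
abbrev xG : w.adicCompletion L := 1 + 2 * ζc w

/-- `v(x) = 1`. -/
theorem val_xG : Valued.v (xG w) = 1 := by
  unfold xG
  have hlt : Valued.v (2 * ζc w) < Valued.v (1 : w.adicCompletion L) := by
    rw [map_mul, val_ζc, mul_one, Valuation.map_one]
    exact val_two_c_lt_one w
  rw [add_comm, Valuation.map_add_eq_of_lt_right _ hlt, Valuation.map_one]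

/-- `x ≠ 0`. -/
theorem xG_ne_zero : xG w ≠ 0 := by
  intro h
  have := val_xG w
  rw [h, Valuation.map_zero] at this
  exact zero_ne_one this

/-- `σ(x) = 1 − 2ζ` for non-trivial `σ`. -/
theorem algEquiv_xG (σ : Gal(w.adicCompletion L/v₂.adicCompletion ℚ)) (hσ : σ ≠ 1) :
    σ (xG w) = 1 - 2 * ζc w := by
  unfold xG
  rw [map_add, map_one, map_mul, map_ofNat, algEquiv_zetaw w σ hσ]
  ring

/-- `y := σ(x)/x` is not a root of unity: `v(y − 1) = v(4) < v(2)`. -/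
theorem pow_ne_one_yG (σ : Gal(w.adicCompletion L/v₂.adicCompletion ℚ)) (hσ : σ ≠ 1) (n : ℕ) (hn : 1 ≤ n) :
    (σ (xG w) / xG w) ^ n ≠ 1 := by
  have hx := xG_ne_zero w
  have hy1 : σ (xG w) / xG w - 1 = -(4 * ζc w) / xG w := by
    rw [algEquiv_xG w σ hσ]
    field_simp
    ring
  have hv : Valued.v (σ (xG w) / xG w - 1) < Valued.v (2 : w.adicCompletion L) := by
    rw [hy1, map_div₀, Valuation.map_neg, map_mul, val_ζc, mul_one, val_xG, div_one]
    have h4 : (4 : w.adicCompletion L) = 2 * 2 := by norm_num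
    rw [h4, map_mul, val_two_c, ← WithZero.exp_add]
    exact WithZero.exp_lt_exp.mpr (by norm_num)
  have hζ0 : ζc w ≠ 0 := by
    intro h0
    have := val_ζc w
    rw [h0, Valuation.map_zero] at this
    exact zero_ne_one this
  have hne : σ (xG w) / xG w ≠ 1 := by
    intro h
    have h0 : σ (xG w) / xG w - 1 = 0 := sub_eq_zero.mpr h
    rw [hy1, div_eq_zero_iff, neg_eq_zero, mul_eq_zero] at h0
    rcases h0 with (h4 | h4) | h4
    · exact (by norm_num : (4 : w.adicCompletion L) ≠ 0) h4
    · exact hζ0 h4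
    · exact hx h4
  exact pow_ne_one_of_val_sub_one_lt w (val_two_le_val_prime w) _ hne hv n hn

/-- `x` as a unit of `L_w`. -/
abbrev xU : (w.adicCompletion L)ˣ := Units.mk0 (xG w) (xG_ne_zero w)

/-- A power `x^n` (`n ≥ 1`) does not lie in `K_v^×`. -/
theorem xU_pow_notMem_Fsub (σ : Gal(w.adicCompletion L/v₂.adicCompletion ℚ)) (hσ : σ ≠ 1) (n : ℕ) (hn : 1 ≤ n) :
    xU w ^ n ∉ Fsub v₂ w := by
  rintro ⟨u, hu⟩
  have hval : xG w ^ n = algebraMap (v₂.adicCompletion ℚ) (w.adicCompletion L) (u : v₂.adicCompletion ℚ) := by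
    have := congrArg (fun y : (w.adicCompletion L)ˣ => (y : w.adicCompletion L)) hu
    simp only [Units.val_pow_eq_pow_val, Units.val_mk0] at this
    exact this.symm
  have hfix : σ (xG w) ^ n = xG w ^ n := by
    rw [← map_pow, hval]
    exact AlgEquiv.commutes σ _
  apply pow_ne_one_yG w σ hσ n hn
  rw [div_pow, hfix]
  exact div_self (pow_ne_zero _ (xG_ne_zero w))

/-- The class of `x` in `U(V) = L_w^×/K_v^×` has infinite order: no non-zero multiple vanishes. -/
theorem zsmul_xQ_ne_zero (σ : Gal(w.adicCompletion L/v₂.adicCompletion ℚ)) (hσ : σ ≠ 1) (k : ℤ) (hk0 : k ≠ 0) :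
    k • (Additive.ofMul (xU w : (w.adicCompletion L)ˣ ⧸ Fsub v₂ w) : QuotA v₂ w) ≠ 0 := by
  intro hk
  have hk' : ((xU w : (w.adicCompletion L)ˣ ⧸ Fsub v₂ w) ^ k : (w.adicCompletion L)ˣ ⧸ Fsub v₂ w) = 1 := by
    have := hk
    rw [← ofMul_zpow, ← ofMul_one] at this
    exact Additive.ofMul.injective this
  rw [← QuotientGroup.mk_zpow, QuotientGroup.eq_one_iff] at hk'
  rcases lt_or_gt_of_ne hk0 with hneg | hpos
  · obtain ⟨n, hn⟩ : ∃ n : ℕ, k = -(n : ℤ) := ⟨k.natAbs, by omega⟩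
    have hn1 : 1 ≤ n := by omega
    rw [hn, zpow_neg, zpow_natCast] at hk'
    exact xU_pow_notMem_Fsub w σ hσ n hn1 ((Fsub v₂ w).inv_mem_iff.mp hk')
  · obtain ⟨n, hn⟩ : ∃ n : ℕ, k = (n : ℤ) := ⟨k.natAbs, by omega⟩
    have hn1 : 1 ≤ n := by omega
    rw [hn, zpow_natCast] at hk'
    exact xU_pow_notMem_Fsub w σ hσ n hn1 hk'

/-! ### A conjugate-orthogonal character with infinite image -/

/-- THE DISCONTINUOUS CHARACTER: a conjugate-orthogonal character of `L_w^×` whose kernel does NOT have finite index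
(Baer extension of `n ↦ n` from the infinite cyclic subgroup generated by the class of `x`, followed by `exp`). -/
theorem exists_isCO_not_finiteIndex (σ : Gal(w.adicCompletion L/v₂.adicCompletion ℚ)) (hσ : σ ≠ 1) :
    ∃ ξ : (w.adicCompletion L)ˣ →* ℂˣ, (∀ f ∈ Fsub v₂ w, ξ f = 1) ∧ ¬ ξ.ker.FiniteIndex := by
  set q : QuotA v₂ w := Additive.ofMul (xU w : (w.adicCompletion L)ˣ ⧸ Fsub v₂ w) with hq
  have hq' : ∀ k : ℤ, k ≠ 0 → k • q ≠ 0 := zsmul_xQ_ne_zero w σ hσ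
  -- the inclusion `ℤ → U(V)`, `n ↦ n • q`, is injective
  let f : ℤ →+ QuotA v₂ w := zmultiplesHom (QuotA v₂ w) q
  have hf : ∀ n : ℤ, f n = n • q := fun n => rfl
  have hinj : Function.Injective f := by
    intro a b hab
    have h0 : f (a - b) = 0 := by rw [map_sub, hab]; exact sub_self (f b)
    rw [hf] at h0
    by_contra hne
    exact hq' (a - b) (sub_ne_zero.mpr hne) h0
  obtain ⟨h, hh⟩ := @Module.Baer.extension_property_addMonoidHom ℂ _ ℤ (QuotA v₂ w) _ _
    (Module.Baer.of_divisible ℂ) f hinj (zmultiplesHom ℂ 1)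
  have hhn : ∀ n : ℤ, h (n • q) = n := fun n => by
    have := congrArg (fun φ : ℤ →+ ℂ => φ n) hh
    simp only [AddMonoidHom.comp_apply, zmultiplesHom_apply, zsmul_eq_mul, mul_one] at this
    rw [← hf]
    exact this
  -- the character `exp ∘ h ∘ (quotient)`
  let ξ : (w.adicCompletion L)ˣ →* ℂˣ :=
    { toFun := fun x => Units.mk0 (Complex.exp (h (Additive.ofMul (x : (w.adicCompletion L)ˣ ⧸ Fsub v₂ w))))
        (Complex.exp_ne_zero _)
      map_one' := by
        apply Units.ext
        simp
      map_mul' := fun x y => by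
        apply Units.ext
        simp [Complex.exp_add, ofMul_mul] }
  have hξ : ∀ x : (w.adicCompletion L)ˣ, ((ξ x : ℂˣ) : ℂ) =
      Complex.exp (h (Additive.ofMul (x : (w.adicCompletion L)ˣ ⧸ Fsub v₂ w))) := fun x => rfl
  refine ⟨ξ, fun f hf => ?_, ?_⟩
  · apply Units.ext
    rw [hξ, (QuotientGroup.eq_one_iff _).mpr hf, ofMul_one, map_zero, Complex.exp_zero, Units.val_one]
  · -- the image contains `exp n` for every `n : ℕ`, an infinite set
    intro hfin
    have hcard : ξ.ker.index ≠ 0 := Subgroup.finiteIndex_iff.mp hfin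
    rw [Subgroup.index_ker] at hcard
    haveI : Finite ξ.range := Nat.finite_of_card_ne_zero hcard
    have hmem : ∀ n : ℕ, (Units.mk0 (Complex.exp (n : ℂ)) (Complex.exp_ne_zero _) : ℂˣ) ∈ ξ.range := by
      intro n
      refine ⟨xU w ^ n, ?_⟩
      apply Units.ext
      rw [hξ, Units.val_mk0]
      congr 1
      have : (Additive.ofMul ((xU w ^ n : (w.adicCompletion L)ˣ) : (w.adicCompletion L)ˣ ⧸ Fsub v₂ w)) =
          (n : ℤ) • q := by
        rw [hq, QuotientGroup.mk_pow, ofMul_pow, natCast_zsmul]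
      rw [this, hhn]
      rfl
    let g : ℕ → ξ.range := fun n => ⟨_, hmem n⟩
    have hg : Function.Injective g := by
      intro a b hab
      have h1 : Complex.exp (a : ℂ) = Complex.exp (b : ℂ) := by
        have := congrArg (fun x : ξ.range => ((x : ℂˣ) : ℂ)) hab
        simpa [g] using this
      rw [← Complex.ofReal_natCast, ← Complex.ofReal_natCast, ← Complex.ofReal_exp, ← Complex.ofReal_exp] at h1
      exact Nat.cast_injective (Real.exp_injective (Complex.ofReal_injective h1))
    exact not_injective_infinite_finite g hg

/-! ### The superseded statement of record is vacuous at `ℚ₂ ⊆ ℚ₂(i)` -/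

/-- **THE HYPOTHESES OF `N5Local_main_ram_completion_weil'` (p409783) ARE JOINTLY FALSE at `ℚ₂ ⊆ ℚ₂(i)`**, for every
choice of the place data, the parameters `P`, `ψ_δ` and the Weil representations `R`: `h35 → (∀ s, hsm s) → False`. -/
theorem primed_hypotheses_false (h2 : Module.finrank (v₂.adicCompletion ℚ) (w.adicCompletion L) = 2)
    {π : w.adicCompletionIntegers L} (hπ : Irreducible π)
    (σ : Gal(w.adicCompletion L/v₂.adicCompletion ℚ)) (hσ : σ ≠ 1)
    (P : TateParams (w.adicCompletion L)ˣ (PsiC w) ℝ) (ψδ : PsiC w) (R : WeilRep v₂ w)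
    (h35 : Hyp.BFGYYZ2025_Thm3_5
      (mkRamWeil v₂ w h2 hπ σ hσ P ψδ (toCarrier v₂ w R)).toWeil.toLocalSignDatum)
    (hsm : ∀ s, (mkRamWeil v₂ w h2 hπ σ hσ P ψδ (toCarrier v₂ w R)).toWeil.IsSmoothCompact s) : False := by
  obtain ⟨ξ, hCO, hnot⟩ := exists_isCO_not_finiteIndex w σ hσ
  apply hnot
  refine finiteIndex_ker_of_h35_hsm_ram v₂ w h2 hπ σ hσ P ψδ R h35 hsm ξ ?_
  exact (N5LocalCharDatum.CharDatum.isCO_iff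
    (mkRamWeil v₂ w h2 hπ σ hσ P ψδ (toCarrier v₂ w R)).D.toCharDatum ξ).mpr fun x => hCO x.1 x.2

end Gaussian

end

end Summit.Ventures.HodgeRepro2.T6.N5LocalGaussianRefutation
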